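/-
Copyright: the b2b-balaban T⁴-continuum CRUX team, row NE7b leaf lineage `t4-ne7b-formalise-leaf-06` (gen 159). Project licence.
-/
import Summits.QuantumFields.BalabanUV.T4Continuum.Spine.NE7b.OneShotChartMixedNormZd
import Summits.QuantumFields.BalabanUV.T4Continuum.Spine.NE7b.OneShotChartReflection
import Summits.QuantumFields.BalabanUV.T4Continuum.Spine.NE7b.BlockSectionRowSumValue

/-!
# THE MIXED-CURRENCY CHART LETTER OF THE ONE-SHOT SECTION AT SIDE 2 ON `ℤ⁴`, BY VALUE, AT KERNEL WEIGHT (modulo leaf-01's `native_decide`):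
# `RMS_{B(y″)}(HB) ≤ √(1 + 1.594²)·‖B‖_∞ = 1.8817…·‖B‖_∞ < 2·‖B‖_∞` for every bounded coarse field `B` and every block `y″`
# (row NE7b, node U5c; the junction of leaf-01's computational row-sum number (BSRV), the home-block identity (OSCRF) and the A-certificate on `ℤ^d`
# (OSCAC ∕ OSCMNZ); PRICING-NE7b v122 F727 (d) «K_mix(2) ≤ 1.33 < 2 … UNPROVED» ∕ OWNER RULING W-ne7bp1-g113-3 (the currency of record) — [folklore] junction)

Cell `pub-balaban`, sub-cell `t4`, spine estimate NE7b (`T4WeightBudget.RelWeightBound`; the cell's OWN estimate — NOT PRINTED in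
[Bałaban 1983–89], NOT PROVED).  Crux-route work under `Spine/NE7b/` by leaf-06 (CRUX team (2), FREEZE (0) crux-prover clause).  NOTHING of
Bałaban's is named as a Lean object, valued or asserted; no `def`; zero `sorry`.  COMPUTATIONAL TAINT BY IMPORT: `rowSum_value` (leaf-01's
`BlockSectionRowSumValue`, three `native_decide` facts) is an input, so every theorem here carries those three compiler-trust axioms — filed in
the `--computational` lane.  Imports: OSCMNZ (the A-certificate on `ℤ^d`), OSCRF (the home-block identity and the row junction), BSRV.

WHAT IS PROVED (d = 4, side 2, `a > 0`; [folklore] junction):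
* `rowTail_le_side_two`: for every `p` and every finite `T′ ∋ blk 1 p`, `Σ_{y∈T′∖{blk 1 p}}|H(p,y)| ≤ 1594∕1000` (BSRV's `2594∕1000` minus the exact
  home entry `1` of OSCRF).
* **`blockRMS_HBZd_le_side_two`**: `|B| ≤ R` ⇒ `√(2^{−4}Σ_{p∈B(y″)}(HB)(p)²) ≤ R·√(1 + (1594∕1000)²)` — OSCMNZ's `blockRMS_HBZd_le_of_rowCertificate_add_tail`
  with the window `{y″}`, `ρ = 0`, `τ = 1594∕1000`.
* `mixedConst_side_two_lt_two`: `√(1 + (1594∕1000)²) < 2` (so the letter `K_mix(2) < M = 2` of the hard-step cell's radius bookkeeping holds by value).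

HONEST: a by-value letter of NL-NE7b-1′ limb 1b in the currency of record at ONE side (M = 2, d = 4), at kernel weight MODULO `native_decide`; about the
FREE scalar block-mean section — NOT Bałaban's estimate; nothing of (A3) ∕ NC-NE7b-α.  BY-NAME EFFECT ON THE WALL: NONE.  NE7b NOT PRINTED ∕ NOT
PROVED; spine PROVED 0∕9; rung (B)+1 on a FINITE torus — NOT infinite volume, NOT the mass gap, NOT Clay.  HONEST DEPENDENCY: continuum YM on T⁴ ⇐
BetaPertH ∧ nine spine estimates (0∕9 proved); BetaPertH ⇐ (D1) ∧ (D4) ∧ CAP+tail; G-an2-4 gates asym, D1 and NE2∕3∕4.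
-/

set_option autoImplicit false

namespace Summit.QuantumFields.BalabanUV.T4Continuum.NE7b.OneShotChartMixedLetterSideTwo

open Finset
open Literature.MathematicalPhysics.QuantumFieldTheory.Balaban1983to89
open B6QGQLower276 (X B blk mem_B)
open B5Hk103ScalarZd (kerH)
open B5Hk165L2Zd (HBZd)

/-- **THE OFF-HOME ROW MASS AT SIDE 2, `d = 4`**: `Σ_{y∈T′∖{blk 1 p}}|H(p,y)| ≤ 1594∕1000` for every finite `T′ ∋ blk 1 p` (BSRV's `2594∕1000` minus
the exact home entry `1`). [folklore junction; computational by import] -/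
theorem rowTail_le_side_two {a : ℝ} (ha : 0 < a) (p : X 4) {T' : Finset (X 4)} (hT : blk 1 p ∈ T') :
    ∑ y ∈ T' \ {blk 1 p}, |kerH 1 a p y| ≤ 1594 / 1000 := by
  have h := OneShotChartReflection.rowCertificate_one_of_rowSum_le ha p (BlockSectionRowSumValue.rowSum_value ha p).2 hT
  rw [OneShotChartReflection.kerH_one_home_eq_one ha p, sub_self, abs_zero, zero_add, ← Finset.sdiff_singleton_eq_erase] at h
  linarith

/-- **THE MIXED LETTER AT SIDE 2 BY VALUE**: for every block `y″` and every bounded coarse field `|B| ≤ R` on `ℤ⁴`,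
`√(2^{−4}Σ_{p∈B(y″)}(HB)(p)²) ≤ R·√(1 + (1594∕1000)²)` — i.e. `K_mix(2) ≤ 1.8817…` at kernel weight modulo `native_decide`. [folklore junction;
computational by import] -/
theorem blockRMS_HBZd_le_side_two {a : ℝ} (ha : 0 < a) (y'' : X 4) {Bf : X 4 → ℝ} {R : ℝ} (hB : ∀ y, |Bf y| ≤ R) :
    Real.sqrt (((((1 : ℕ) : ℝ) + 1) ^ 4)⁻¹ * ∑ p ∈ B 1 y'', HBZd 1 a Bf p ^ 2) ≤ R * Real.sqrt (1 + (1594 / 1000) ^ 2) := by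
  have h := OneShotChartMixedNormZd.blockRMS_HBZd_le_of_rowCertificate_add_tail 1 ha y'' (T := {y''}) (Finset.mem_singleton_self y'')
    (ρ := 0) (τ := 1594 / 1000) (fun p hp => ?_) (fun T' hT' p hp => ?_) hB
  · simpa using h
  · -- on the one-block window the row certificate is the home identity: `|H(p, y″) − 1| + Σ_∅ = 0`
    have hy : blk 1 p = y'' := mem_B.1 hp
    rw [Finset.erase_singleton, Finset.sum_empty, add_zero, ← hy, OneShotChartReflection.kerH_one_home_eq_one ha p, sub_self, abs_zero]
  · -- the finitary tail: every `T′ ⊇ {y″}` has off-home row mass `≤ 1.594`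
    have hy : blk 1 p = y'' := mem_B.1 hp
    have hmem : blk 1 p ∈ T' := hT' (by rw [hy]; exact Finset.mem_singleton_self y'')
    rw [← hy]
    exact rowTail_le_side_two ha p hmem

/-- `√(1 + 1.594²) < 2` (`1 + 1.594² = 3.540836 < 4`). -/
theorem mixedConst_side_two_lt_two : Real.sqrt (1 + (1594 / 1000 : ℝ) ^ 2) < 2 := by
  rw [show (2 : ℝ) = Real.sqrt 4 by rw [show (4 : ℝ) = 2 ^ 2 by norm_num, Real.sqrt_sq (by norm_num)]]
  exact Real.sqrt_lt_sqrt (by positivity) (by norm_num)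

end Summit.QuantumFields.BalabanUV.T4Continuum.NE7b.OneShotChartMixedLetterSideTwo
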